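import Summits.BirchSwinnertonDyer.BirchSwinnertonDyer.Theorems.ByReductionTypeAtTwoRankOneAtTwoFklDefs
import Summits.BirchSwinnertonDyer.BirchSwinnertonDyer.Theorems.ByReductionTypeAtTwoRankOneAtTwoBigImageOddLocalFklFirstNonVanishingLevel
import Summits.BirchSwinnertonDyer.BirchSwinnertonDyer.Theorems.ByReductionTypeAtTwoRankOneAtTwoBigImageOddLocalStubShaAnRationalOnSlice
import Literature.Barriers.BirchSwinnertonDyer.PAdicFunctionalEquationParityProofs
import Literature.NumberTheory.EllipticCurves.NonEisensteinPrimeOfSurjective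
import HarnessLib

/-!
# Line `fkl` of crux `RankOneAtTwoBigImageOddLocal` (stmt-BirchSwinnertonDyer-23715, route ByReductionTypeAtTwo):
# TWIST PARITY — off the corner `{Ш[2] ≠ 0 ∧ Ш_an even}` only LEVEL TWO of the first layer is load-bearing, and level two is
# «`L(E^{(ℓ)},1)/Ω(E^{(ℓ)}) mod 4` for prime quadratic twists»

Lead prover seat `bsd-line-fkl-p1` (g5), helper `--supports stmt-BirchSwinnertonDyer-23715`; sequel to `…FklAssembly` (p606641: the two
HALF-SLICES `{Ш(E)[2] = 0}` ↦ (NV, HC_an), `{Ш_an odd}` ↦ (HC, NV_an)) and to g2's `…FklLevelShift` / `…FklFirstNonVanishingLevel` (level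
shift; level two = `T_ℓ(f) mod 4`).

THE POINT.  On each half-slice the two load-bearing residues are only used through their rows of level `k ≥ 2` at strength `4`
(`δ'_k ∈ / ∉ 4ℤ_{(2)}`), and by the iterated level shift every such row reduces to the level-`2` row, which is the prime quadratic twist
`T_ℓ(f) = twistSymbolSum f ℓ` (`= L(E^{(ℓ)},1)/Ω(E^{(ℓ)})`, REF1 §56 788/788) modulo `4`.  So off the corner `{Ш[2] ≠ 0 ∧ 2 ∣ Ш_an}` the
crux is a statement about PRIME QUADRATIC TWISTS MODULO 4 — the four «level-two shadows» of `…RankOneAtTwoFklDefs` (APPEND, this gen):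
* `levelTwoTwistCongruence_of_higherCongruence` : (HC) ⟹ (L2-HC) `LevelTwoTwistCongruenceAtTwo`; analytic twin likewise;
* `levelTwoTwistNonVanishing_of_nonVanishing` : (NV) ⟹ (L2-NV) `LevelTwoTwistNonVanishingAtTwo` (and conversely (L2-NV) gives (NV) at
  every curve with `Ш[2^∞]` trivial: `…FklLevelShift.stub_firstLayerNonVanishing_of_sha_trivial_of_twist'`); analytic twin likewise;
* `bsdp_two_of_sha_two_trivial_of_twistParity` / `bsdp_two_on_shaTwoTrivial_of_levelTwo` : on `{Ш(E)[2] = 0}`,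
  `BSDp W 2 ⟸` printed facts ∧ Manin ∧ integrality ∧ (L2-NV) ∧ (L2-HC_an);
* `bsdp_two_of_shaAn_unit_of_twistParity` / `bsdp_two_on_shaAnUnit_of_levelTwo` : on `{Ш_an odd}`,
  `BSDp W 2 ⟸` printed facts ∧ Manin ∧ (L2-HC) ∧ (L2-NV_an).
Reading (not kernel): (L2-HC) and the (⇐)-content of (L2-NV) are, by 2-descent at a `τ`-prime (one-dimensional local condition) and the
rank-0 BSD₂ / Kato bound at `2` for the twist `E^{(ℓ)}` (same reduction type at `2` as `E` when `ℓ ≡ 1 (8)`), statements of the kind the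
route's own rank-0 cruxes make; the genuinely analytic content off the corner is (L2-HC_an) ∧ (L2-NV_an): «`Ш_an(E)` is odd iff some
`τ`-prime twist has `L^{alg}(E^{(ℓ)},1) ≡ 2 (mod 4)`».  Theorems only; no `def`, no `sorry`; conjecture / named-fact hypotheses
displayed.  This module is ROUTE-INDEPENDENT (no Theses import; the three slice book-keeping lemmas of `…FklAssembly` are re-proved in
one combined lemma `rootNumber_and_periodTransfer_of_slice`).  BSD is not proved by any of this.
-/

set_option autoImplicit false

noncomputable section

open scoped Classical MatrixGroups ModularForm

set_option linter.dupNamespace false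

namespace Summit.BirchSwinnertonDyer.BirchSwinnertonDyer.Theorems.RankOneAtTwoFkl

open CongruenceSubgroup WeierstrassCurve Literature.NumberTheory.EllipticCurves
  Literature.NumberTheory.EllipticCurves.ModularForms Summit.BirchSwinnertonDyer.Rank1Residual.F1Sign2

/-! ## Slice bookkeeping (one route-independent lemma; `…FklAssembly` has the un-primed versions but imports the route file) -/

/-- For a slice curve of analytic rank `1` with a newform `f` at the conductor: `w = −1` (parity barrier lemma) and, from the three
Manin statements (Abbes–Ullmo `2 ∤ N`, Česnavičius `2 ∥ N`, `ManinOddAdditiveAtTwo` `4 ∣ N`) and the tree's PROVED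
`SkinnerUrban2014.exists_unit_mul_plusPeriod_of_irreducible_anyPrime`, the period transfer at `2`. [conjecture] inputs displayed;
kernel glue. -/
theorem rootNumber_and_periodTransfer_of_slice
    (hAU : abbesUllmo_not_dvd_maninConstant_of_not_dvd_level) (hC : cesnavicius_not_two_dvd_maninConstant_of_two_dvd_level)
    (h4 : ManinOddAdditiveAtTwo)
    (W : WeierstrassCurve ℚ) [W.IsElliptic] [W.IsGloballyMinimal] [NeZero (W.conductorNorm ℤ)]
    (f : CuspForm (Gamma0 (W.conductorNorm ℤ)) 2) (hf : IsNewformOf W f)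
    (hsurj : ∀ n : ℕ, W.HasSurjectiveModNGaloisRep ((2 ^ n : ℕ) : ℤ)) (han : W.analyticRank = 1) :
    W.rootNumber = -1 ∧ PeriodTransferAtTwo W f := by
  refine ⟨?_, ?_⟩
  · rcases W.rootNumber_eq_one_or with h | h
    · exfalso
      have hev : Even W.analyticRank :=
        (Literature.Barriers.BirchSwinnertonDyer.even_analyticRank_iff_of_isNewformOf_conductorLevel hf).mpr h
      rw [han] at hev
      exact Nat.not_even_one hev
    · exact h
  · refine SkinnerUrban2014.exists_unit_mul_plusPeriod_of_irreducible_anyPrime W 2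
      (hasIrreducibleModPGaloisRep_of_hasSurjectiveModNGaloisRep W 2 (by simpa using hsurj 1)) f hf fun W₀ _ _ D₀ _ hopt => ?_
    by_cases h2 : 2 ∣ W.conductorNorm ℤ
    · by_cases h4N : 2 ^ 2 ∣ W.conductorNorm ℤ
      · exact h4 W₀ D₀ hopt h4N
      · exact hC W₀ D₀ hopt h2 h4N
    · exact_mod_cast hAU W₀ D₀ hopt 2 Nat.prime_two h2

/-! ## Small arithmetic -/

/-- `(2^2 : ℤ) ∣ ℓ − 1` in `ℤ` gives `4 ∣ ℓ − 1` and `2^2 ∣ ℓ − 1` in `ℕ` (for `ℓ ≥ 1`). [folklore] -/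
theorem four_dvd_sub_one_of_int {ℓ : ℕ} (hℓ : 1 ≤ ℓ) (h : (2 ^ 2 : ℤ) ∣ (ℓ : ℤ) - 1) : 4 ∣ ℓ - 1 ∧ 2 ^ 2 ∣ ℓ - 1 := by
  have : ((2 ^ 2 : ℕ) : ℤ) ∣ ((ℓ - 1 : ℕ) : ℤ) := by push_cast [Nat.cast_sub hℓ]; exact h
  have h' : 2 ^ 2 ∣ ℓ - 1 := Int.natCast_dvd_natCast.mp this
  exact ⟨by norm_num at h'; exact h', h'⟩

/-! ## Every row of level `≥ 2` at strength `4` is the level-two row, i.e. `T_ℓ mod 4` -/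

/-- **Strength-`4` membership of ANY row of level `k ≥ 2` is `T_ℓ(f) ∈ 4ℤ_{(2)}`** (positive analytic rank, `τ`-prime `ℓ ∤ N`,
`2^k ∣ ℓ − 1`, `ψ` onto `ℤ/2^k`): iterate the level shift down to level `2` (`inTwoPowZLoc_levelSumTwo_iff_reduction`, `m = 2 ≤ 3`), then
`inTwoPowZLoc_levelSumTwo_two_iff_twist`. [folklore] -/
theorem inTwoPowZLoc_two_levelSumTwo_iff_twist (W : WeierstrassCurve ℚ) [W.IsElliptic] [W.IsGloballyMinimal]
    {M : ℕ} [NeZero M] (f : CuspForm (Gamma0 M) 2) (hf : IsNewformOf W f) (hr : W.analyticRank ≠ 0)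
    {ℓ : ℕ} [Fact ℓ.Prime] (hlev : IsLevelAtTwo W ℓ) {k : ℕ} (hk : 2 ≤ k) (hℓk : (2 ^ k : ℤ) ∣ (ℓ : ℤ) - 1)
    (ψ : (ZMod ℓ)ˣ →* Multiplicative (ZMod (2 ^ k))) (hψ : Function.Surjective ψ) :
    InTwoPowZLoc 2 (levelSumTwo f ℓ k ψ) ↔ InTwoPowZLoc 2 (twistSymbolSum f ℓ) := by
  have hℓ : ℓ.Prime := Fact.out
  obtain ⟨hℓ2, hN⟩ := ne_two_and_not_dvd_of_isLevelAtTwo W hlev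
  have h1 : 1 ≤ ℓ := hℓ.one_lt.le
  obtain ⟨d, rfl⟩ : ∃ d, k = 2 + d := ⟨k - 2, by omega⟩
  have h1nat : 2 ^ (2 + d) ∣ ℓ - 1 := by
    have : ((2 ^ (2 + d) : ℕ) : ℤ) ∣ ((ℓ - 1 : ℕ) : ℤ) := by push_cast [Nat.cast_sub h1]; exact hℓk
    exact Int.natCast_dvd_natCast.mp this
  have h4 : 4 ∣ ℓ - 1 := by
    have := dvd_trans (pow_dvd_pow 2 (show 2 ≤ 2 + d by omega)) h1nat
    norm_num at this
    exact this
  obtain ⟨ψ', hψ's, hψ'⟩ := exists_levelChar_reduction_le d 2 ψ hψ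
  rw [inTwoPowZLoc_levelSumTwo_iff_reduction W f hf hr hℓ2 hN d 2 ψ hψ h1nat ψ' hψ' (m := 2) (by omega)]
  exact inTwoPowZLoc_levelSumTwo_two_iff_twist W f hf hr hN h4 ψ' hψ's le_rfl

/-- **All rows of level `≥ 2` lie in `4ℤ_{(2)}` iff every `τ`-prime of level `≥ 2` has `T_ℓ(f) ∈ 4ℤ_{(2)}`** (positive analytic
rank). [folklore] -/
theorem forall_rows_inTwoPowZLoc_two_iff_twist (W : WeierstrassCurve ℚ) [W.IsElliptic] [W.IsGloballyMinimal]
    {M : ℕ} [NeZero M] (f : CuspForm (Gamma0 M) 2) (hf : IsNewformOf W f) (hr : W.analyticRank ≠ 0) :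
    (∀ (ℓ k : ℕ) [Fact ℓ.Prime], IsLevelAtTwo W ℓ → 2 ≤ k → (2 ^ k : ℤ) ∣ (ℓ : ℤ) - 1 →
        (2 ^ k : ℤ) ∣ W.frobeniusTrace ℓ - 2 →
        ∀ ψ : (ZMod ℓ)ˣ →* Multiplicative (ZMod (2 ^ k)), Function.Surjective ψ →
          InTwoPowZLoc 2 (levelSumTwo f ℓ k ψ)) ↔
    (∀ (ℓ : ℕ) [Fact ℓ.Prime], IsLevelAtTwo W ℓ → (2 ^ 2 : ℤ) ∣ (ℓ : ℤ) - 1 → (2 ^ 2 : ℤ) ∣ W.frobeniusTrace ℓ - 2 →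
        InTwoPowZLoc 2 (twistSymbolSum f ℓ)) := by
  constructor
  · intro h ℓ _ hlev h4 ha
    have hℓ : ℓ.Prime := Fact.out
    obtain ⟨-, h4nat⟩ := four_dvd_sub_one_of_int hℓ.one_lt.le h4
    obtain ⟨ψ, hψ⟩ := exists_surjective_levelChar (ℓ := ℓ) h4nat
    have hrow := h ℓ 2 hlev le_rfl h4 ha ψ hψ
    rwa [inTwoPowZLoc_two_levelSumTwo_iff_twist W f hf hr hlev le_rfl h4 ψ hψ] at hrow
  · intro h ℓ k _ hlev hk hℓk ha ψ hψ
    rw [inTwoPowZLoc_two_levelSumTwo_iff_twist W f hf hr hlev hk hℓk ψ hψ]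
    exact h ℓ hlev (dvd_trans (pow_dvd_pow 2 hk) hℓk) (dvd_trans (pow_dvd_pow 2 hk) ha)

/-- **Some row of level `≥ 2` lies outside `4ℤ_{(2)}` iff some `τ`-prime of level `≥ 2` has `T_ℓ(f) ∉ 4ℤ_{(2)}`** (positive
analytic rank; = `clauseB_iff_level` at parameter `0` read through level two). [folklore] -/
theorem exists_row_not_inTwoPowZLoc_two_iff_twist (W : WeierstrassCurve ℚ) [W.IsElliptic] [W.IsGloballyMinimal]
    {M : ℕ} [NeZero M] (f : CuspForm (Gamma0 M) 2) (hf : IsNewformOf W f) (hr : W.analyticRank ≠ 0) :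
    (∃ (ℓ k : ℕ) (_ : Fact ℓ.Prime) (ψ : (ZMod ℓ)ˣ →* Multiplicative (ZMod (2 ^ k))),
        IsLevelAtTwo W ℓ ∧ 0 + 2 ≤ k ∧ (2 ^ k : ℤ) ∣ (ℓ : ℤ) - 1 ∧ (2 ^ k : ℤ) ∣ W.frobeniusTrace ℓ - 2 ∧
        Function.Surjective ψ ∧ ¬ InTwoPowZLoc (0 + 2) (levelSumTwo f ℓ k ψ)) ↔
    (∃ (ℓ : ℕ) (_ : Fact ℓ.Prime), IsLevelAtTwo W ℓ ∧ (2 ^ 2 : ℤ) ∣ (ℓ : ℤ) - 1 ∧ (2 ^ 2 : ℤ) ∣ W.frobeniusTrace ℓ - 2 ∧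
        ¬ InTwoPowZLoc 2 (twistSymbolSum f ℓ)) := by
  constructor
  · rintro ⟨ℓ, k, hℓF, ψ, hlev, hk, hℓk, ha, hψ, hnot⟩
    refine ⟨ℓ, hℓF, hlev, dvd_trans (pow_dvd_pow 2 (by omega)) hℓk, dvd_trans (pow_dvd_pow 2 (by omega)) ha, ?_⟩
    rwa [zero_add, inTwoPowZLoc_two_levelSumTwo_iff_twist W f hf hr hlev (by omega) hℓk ψ hψ] at hnot
  · rintro ⟨ℓ, hℓF, hlev, h4, ha, hT⟩
    have hℓ : ℓ.Prime := Fact.out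
    obtain ⟨h4nat, -⟩ := four_dvd_sub_one_of_int hℓ.one_lt.le h4
    exact firstLayerNonVanishing_zero_of_twist' W f hf hr ℓ hlev h4nat ha hT

/-! ## The four residues imply their level-two shadows -/

/-- **(HC) ⟹ (L2-HC):** the higher congruence at its level-`2` rows is «`2 ∣ #Ш[2^∞] ⇒ T_ℓ(f) ∈ 4ℤ_{(2)}` at every `τ`-prime of
level `≥ 2`». [conjecture] in, kernel glue. -/
theorem levelTwoTwistCongruence_of_higherCongruence (hHC : FirstLayerHigherCongruenceAtTwo) :
    LevelTwoTwistCongruenceAtTwo := by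
  intro W _ _ M _ f hf hper hsurj hT hc hw hr hfin hs ℓ _ hlev h4 ha
  have hℓ : ℓ.Prime := Fact.out
  have hr0 : W.analyticRank ≠ 0 := (W.analyticRank_pos_of_rootNumber_eq_neg_one hw).ne'
  obtain ⟨-, h4nat⟩ := four_dvd_sub_one_of_int hℓ.one_lt.le h4
  obtain ⟨ψ, hψ⟩ := exists_surjective_levelChar (ℓ := ℓ) h4nat
  have H := hHC W f hf hper hsurj hT hc hw hr hfin
  simp only at H
  have hrow := H hs ℓ 2 hlev le_rfl h4 ha ψ hψ
  rw [show min 2 (padicValNat 2 (Nat.card (AddCommGroup.primaryComponent W.sha 2)) + 1) = 2 by omega] at hrow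
  rwa [inTwoPowZLoc_two_levelSumTwo_iff_twist W f hf hr0 hlev le_rfl h4 ψ hψ] at hrow

/-- **(HC_an) ⟹ (L2-HC_an):** «`ord₂ Ш_an ≥ 1 ⇒ T_ℓ(f) ∈ 4ℤ_{(2)}` at every `τ`-prime of level `≥ 2`». [conjecture] in, kernel glue. -/
theorem analyticLevelTwoTwistCongruence_of_analyticHigherCongruence (hHC : AnalyticFirstLayerHigherCongruenceAtTwo) :
    AnalyticLevelTwoTwistCongruenceAtTwo := by
  intro W _ _ M _ f hf hper hsurj hT hc hw han q hq hq0 hs ℓ _ hlev h4 ha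
  have hℓ : ℓ.Prime := Fact.out
  have hr0 : W.analyticRank ≠ 0 := by rw [han]; exact one_ne_zero
  obtain ⟨-, h4nat⟩ := four_dvd_sub_one_of_int hℓ.one_lt.le h4
  obtain ⟨ψ, hψ⟩ := exists_surjective_levelChar (ℓ := ℓ) h4nat
  have H := hHC W f hf hper hsurj hT hc hw han q hq hq0
  simp only at H
  have hrow := H hs ℓ 2 hlev le_rfl h4 ha ψ hψ
  rw [show min 2 ((padicValRat 2 q).toNat + 1) = 2 by omega] at hrow
  rwa [inTwoPowZLoc_two_levelSumTwo_iff_twist W f hf hr0 hlev le_rfl h4 ψ hψ] at hrow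

/-- **(NV) ⟹ (L2-NV):** for a curve with `Ш[2^∞]` trivial the non-vanishing row (level `≥ 2`, `δ' ∉ 4ℤ_{(2)}`) reduces to a `τ`-prime
twist with `T_ℓ(f) ∉ 4ℤ_{(2)}`. [conjecture] in, kernel glue. -/
theorem levelTwoTwistNonVanishing_of_nonVanishing (hNV : FirstLayerNonVanishingAtTwo) :
    LevelTwoTwistNonVanishingAtTwo := by
  intro W _ _ M _ f hf hper hsurj hT hc hw hr hfin hcard
  have hr0 : W.analyticRank ≠ 0 := (W.analyticRank_pos_of_rootNumber_eq_neg_one hw).ne'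
  have H := hNV W f hf hper hsurj hT hc hw hr hfin
  simp only [hcard, padicValNat_one_right] at H
  exact (exists_row_not_inTwoPowZLoc_two_iff_twist W f hf hr0).mp H

/-- **(NV_an) ⟹ (L2-NV_an):** for `ord₂ Ш_an ≤ 0` the analytic non-vanishing row reduces to a `τ`-prime twist with
`T_ℓ(f) ∉ 4ℤ_{(2)}`. [conjecture] in, kernel glue. -/
theorem analyticLevelTwoTwistNonVanishing_of_analyticNonVanishing (hNV : AnalyticFirstLayerNonVanishingAtTwo) :
    AnalyticLevelTwoTwistNonVanishingAtTwo := by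
  intro W _ _ M _ f hf hper hsurj hT hc hw han q hq hq0 hv
  have hr0 : W.analyticRank ≠ 0 := by rw [han]; exact one_ne_zero
  have hs : (padicValRat 2 q).toNat = 0 := Int.toNat_of_nonpos hv
  have H := hNV W f hf hper hsurj hT hc hw han q hq hq0
  simp only [hs] at H
  exact (exists_row_not_inTwoPowZLoc_two_iff_twist W f hf hr0).mp H

/-! ## The half-slices from the level-two shadows, per curve (fact-free) -/

/-- **Half-slice `{Ш(E)[2] = 0}` from prime quadratic twists mod `4`, per curve.**  A curve of the K2-F setting with `Ш[2^∞]` trivial,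
`Ш_an = q` with `0 ≤ ord₂ q`, SOME `τ`-prime twist with `T_ℓ(f) ∉ 4ℤ_{(2)}` and the analytic congruence «`ord₂ q ≥ 1 ⇒` every
`τ`-prime twist has `T_ℓ(f) ∈ 4ℤ_{(2)}`» satisfies `BSDp W 2` (`ord₂ q = 0 = ord₂ #Ш[2^∞]`). [folklore] kernel glue. -/
theorem bsdp_two_of_sha_two_trivial_of_twistParity
    (W : WeierstrassCurve ℚ) [W.IsElliptic] [W.IsGloballyMinimal] {M : ℕ} (f : CuspForm (Gamma0 M) 2)
    (hr : W.mordellWeilRank = 1) (han : W.analyticRank = 1)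
    (hfin : Finite (AddCommGroup.primaryComponent W.sha 2))
    (hcard : Nat.card (AddCommGroup.primaryComponent W.sha 2) = 1)
    (q : ℚ) (hq : shaAn W = (q : ℂ)) (hint : 0 ≤ padicValRat 2 q)
    (hNV : ∃ (ℓ : ℕ) (_ : Fact ℓ.Prime), IsLevelAtTwo W ℓ ∧ (2 ^ 2 : ℤ) ∣ (ℓ : ℤ) - 1 ∧
      (2 ^ 2 : ℤ) ∣ W.frobeniusTrace ℓ - 2 ∧ ¬ InTwoPowZLoc 2 (twistSymbolSum f ℓ))
    (hHCan : 1 ≤ (padicValRat 2 q).toNat → ∀ (ℓ : ℕ) [Fact ℓ.Prime], IsLevelAtTwo W ℓ → (2 ^ 2 : ℤ) ∣ (ℓ : ℤ) - 1 →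
      (2 ^ 2 : ℤ) ∣ W.frobeniusTrace ℓ - 2 → InTwoPowZLoc 2 (twistSymbolSum f ℓ)) :
    BSDp W 2 := by
  have hv0 : padicValRat 2 q = 0 := by
    by_contra hne
    have hs : 1 ≤ (padicValRat 2 q).toNat := by omega
    obtain ⟨ℓ, hℓF, hlev, h4, ha, hT⟩ := hNV
    exact hT (hHCan hs ℓ hlev h4 ha)
  refine ⟨by rw [hr, han], hfin, q, hq, ?_⟩
  rw [hv0, hcard, padicValNat_one_right]
  simp

/-- **Half-slice `{Ш_an(E) odd}` from prime quadratic twists mod `4`, per curve.**  A curve of the K2-F setting (rank `1` = analytic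
rank, `Ш[2^∞]` finite) with `Ш_an = q` a `2`-adic unit, the algebraic congruence «`2 ∣ #Ш[2^∞] ⇒` every `τ`-prime twist has
`T_ℓ(f) ∈ 4ℤ_{(2)}`» and SOME `τ`-prime twist with `T_ℓ(f) ∉ 4ℤ_{(2)}` satisfies `BSDp W 2` (`#Ш[2^∞]` is odd, hence `ord₂ = 0`).
[folklore] kernel glue. -/
theorem bsdp_two_of_shaAn_unit_of_twistParity
    (W : WeierstrassCurve ℚ) [W.IsElliptic] [W.IsGloballyMinimal] {M : ℕ} (f : CuspForm (Gamma0 M) 2)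
    (hr : W.mordellWeilRank = 1) (han : W.analyticRank = 1)
    (hfin : Finite (AddCommGroup.primaryComponent W.sha 2))
    (q : ℚ) (hq : shaAn W = (q : ℂ)) (hunit : padicValRat 2 q = 0)
    (hHC : 1 ≤ padicValNat 2 (Nat.card (AddCommGroup.primaryComponent W.sha 2)) →
      ∀ (ℓ : ℕ) [Fact ℓ.Prime], IsLevelAtTwo W ℓ → (2 ^ 2 : ℤ) ∣ (ℓ : ℤ) - 1 →
      (2 ^ 2 : ℤ) ∣ W.frobeniusTrace ℓ - 2 → InTwoPowZLoc 2 (twistSymbolSum f ℓ))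
    (hNVan : ∃ (ℓ : ℕ) (_ : Fact ℓ.Prime), IsLevelAtTwo W ℓ ∧ (2 ^ 2 : ℤ) ∣ (ℓ : ℤ) - 1 ∧
      (2 ^ 2 : ℤ) ∣ W.frobeniusTrace ℓ - 2 ∧ ¬ InTwoPowZLoc 2 (twistSymbolSum f ℓ)) :
    BSDp W 2 := by
  have hs0 : padicValNat 2 (Nat.card (AddCommGroup.primaryComponent W.sha 2)) = 0 := by
    by_contra hne
    have hs : 1 ≤ padicValNat 2 (Nat.card (AddCommGroup.primaryComponent W.sha 2)) := by omega
    obtain ⟨ℓ, hℓF, hlev, h4, ha, hT⟩ := hNVan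
    exact hT (hHC hs ℓ hlev h4 ha)
  refine ⟨by rw [hr, han], hfin, q, hq, ?_⟩
  rw [hunit, hs0]
  simp

/-! ## The half-slices from the level-two shadows, by name -/

/-- **On `{Ш(E)[2] = 0}` the crux is a statement about prime quadratic twists mod `4`:** printed facts ∧ `ManinOddAdditiveAtTwo` ∧
`ShaAnTwoIntegralOnBigImageSlice` ∧ (L2-NV) `LevelTwoTwistNonVanishingAtTwo` ∧ (L2-HC_an) `AnalyticLevelTwoTwistCongruenceAtTwo` ⟹
`BSDp W 2` for every slice curve with `#Ш[2^∞] = 1`. [conjecture] inputs displayed; kernel glue. -/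
theorem bsdp_two_on_shaTwoTrivial_of_levelTwo
    (hGZK : rank_eq_analyticRank_of_analyticRank_le_one) (hmod : exists_isNewformOf)
    (hAU : abbesUllmo_not_dvd_maninConstant_of_not_dvd_level) (hC : cesnavicius_not_two_dvd_maninConstant_of_two_dvd_level)
    (hGZ : GrossZagier1986_thm_I_7_3)
    (hNV : LevelTwoTwistNonVanishingAtTwo) (hHCan : AnalyticLevelTwoTwistCongruenceAtTwo)
    (hManin : ManinOddAdditiveAtTwo) (hInt : ShaAnTwoIntegralOnBigImageSlice) :
    ∀ (W : WeierstrassCurve ℚ) [W.IsElliptic] [W.IsGloballyMinimal], ¬ W.HasCM →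
      (∀ n : ℕ, W.HasSurjectiveModNGaloisRep ((2 ^ n : ℕ) : ℤ)) → Odd W.torsionOrder → Odd W.tamagawaProduct →
      W.analyticRank = 1 → Nat.card (AddCommGroup.primaryComponent W.sha 2) = 1 → BSDp W 2 := by
  intro W _ _ hcm hsurj hT hc han hcard
  haveI : NeZero (W.conductorNorm ℤ) := ⟨(W.conductorNorm_pos_holds).ne'⟩
  obtain ⟨f, hf⟩ := hmod W
  obtain ⟨hw, hper⟩ := rootNumber_and_periodTransfer_of_slice hAU hC hManin W f hf hsurj han
  obtain ⟨q, hq, hq0⟩ := exists_rat_shaAn_eq_and_ne_zero_of_analyticRank_eq_one hGZ hGZK W han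
  have hint : 0 ≤ padicValRat 2 q := hInt W hcm hsurj hT hc han q hq
  obtain ⟨hrk, hshafin⟩ := hGZK W (by omega)
  have hr : W.mordellWeilRank = 1 := by omega
  have hfin : Finite (AddCommGroup.primaryComponent W.sha 2) := inferInstance
  exact bsdp_two_of_sha_two_trivial_of_twistParity W f hr han hfin hcard q hq hint
    (hNV W f hf hper hsurj hT hc hw hr hfin hcard) (hHCan W f hf hper hsurj hT hc hw han q hq hq0)

/-- **On `{Ш_an(E) odd}` the crux is a statement about prime quadratic twists mod `4`:** printed facts ∧ `ManinOddAdditiveAtTwo` ∧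
(L2-HC) `LevelTwoTwistCongruenceAtTwo` ∧ (L2-NV_an) `AnalyticLevelTwoTwistNonVanishingAtTwo` ⟹ `BSDp W 2` for every slice curve
whose `Ш_an` is a `2`-adic unit. [conjecture] inputs displayed; kernel glue. -/
theorem bsdp_two_on_shaAnUnit_of_levelTwo
    (hGZK : rank_eq_analyticRank_of_analyticRank_le_one) (hmod : exists_isNewformOf)
    (hAU : abbesUllmo_not_dvd_maninConstant_of_not_dvd_level) (hC : cesnavicius_not_two_dvd_maninConstant_of_two_dvd_level)
    (hGZ : GrossZagier1986_thm_I_7_3)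
    (hHC : LevelTwoTwistCongruenceAtTwo) (hNVan : AnalyticLevelTwoTwistNonVanishingAtTwo)
    (hManin : ManinOddAdditiveAtTwo) :
    ∀ (W : WeierstrassCurve ℚ) [W.IsElliptic] [W.IsGloballyMinimal], ¬ W.HasCM →
      (∀ n : ℕ, W.HasSurjectiveModNGaloisRep ((2 ^ n : ℕ) : ℤ)) → Odd W.torsionOrder → Odd W.tamagawaProduct →
      W.analyticRank = 1 → (∀ q : ℚ, shaAn W = (q : ℂ) → padicValRat 2 q = 0) → BSDp W 2 := by
  intro W _ _ _hcm hsurj hT hc han hunit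
  haveI : NeZero (W.conductorNorm ℤ) := ⟨(W.conductorNorm_pos_holds).ne'⟩
  obtain ⟨f, hf⟩ := hmod W
  obtain ⟨hw, hper⟩ := rootNumber_and_periodTransfer_of_slice hAU hC hManin W f hf hsurj han
  obtain ⟨q, hq, hq0⟩ := exists_rat_shaAn_eq_and_ne_zero_of_analyticRank_eq_one hGZ hGZK W han
  have hq1 : padicValRat 2 q = 0 := hunit q hq
  obtain ⟨hrk, hshafin⟩ := hGZK W (by omega)
  have hr : W.mordellWeilRank = 1 := by omega
  have hfin : Finite (AddCommGroup.primaryComponent W.sha 2) := inferInstance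
  exact bsdp_two_of_shaAn_unit_of_twistParity W f hr han hfin q hq hq1
    (hHC W f hf hper hsurj hT hc hw hr hfin) (hNVan W f hf hper hsurj hT hc hw han q hq hq0 hq1.le)

end Summit.BirchSwinnertonDyer.BirchSwinnertonDyer.Theorems.RankOneAtTwoFkl

end
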